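import Summits.Ventures.LatticeQCDFlow.Exactness.Phi4FlowSymmetricMagnetisationExact
import HarnessLib

/-!
# CAVEAT OF RECORD, SHARPENED: a symmetric exact flow sampler followed by a DETERMINISTIC sign flip has `τ_int(g) = ½ − E_{g²}[r/(1 + r)] < ½` for every odd observable — below independent sampling, at zero cost

HONEST FRAMING: exact (Metropolis-corrected) sampling algorithms for lattice gauge theory;
figures of merit are autocorrelation/cost numbers at stated couplings and volumes; no
continuum-physics claim.  (SCALAR calibration rung S0-A: not a gauge result.)

Venture `LatticeQCDFlow` (cell pub-lqcd), topic `Exactness`; FANOUT row 2 (`s0-phi4`, FLOW arm; the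
exactness battery's figure-of-merit hygiene).  NEW WORK of the cell over `FlowSamplerOddObservableExact`
(a symmetry `σ` of `μ`, `w`, `q̃` makes `K = imhOp μ w q̃` diagonal on odd observables, `K g = r·g`).
Compose each exact step with the deterministic, always-accepted move `x ↦ σx` (lattice φ⁴:
`φ ↦ −φ`; the composite kernel is `π`-invariant and, since `K` commutes with `σ`, reversible).  On
observables the composite acts as `K♭ f = K(f ∘ σ)`; for odd `g`: `K♭ g = −r·g`, `K♭ᵏ g = (−r)ᵏ g`, so
the autocovariances ALTERNATE, `C♭_g(k) = ∫ g² w (−r)ᵏ`, and sum to `−∫ g² w r/(1 + r)`: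

* `imhOp_neg` — `K(−f) = −K f`; **`antithetic_iterate_eq_of_odd`** — `K♭ᵏ g = (−r)ᵏ g`;
* **`antithetic_hasSum_autocov_of_odd`** — `∫ g² w r/(1 − r) < ∞` ⇒
  `Σ_{k≥1} C♭_g(k) = −∫ g² w r/(1 + r)` (`HasSum`; dominated convergence of alternating geometric sums);
* **`antithetic_tauInt_eq_of_odd`** — **`τ_int♭(g) = ½ − (∫ g² w r/(1 + r))/∫ g² w ∈ (0, ½]`**: strictly
  below the i.i.d. value `½` unless `r = 0` `g²w`-a.e.
* Lattice: **`phi4FlowAntithetic_tauInt_magnetisation_eq`** — for EVERY network `q̃`, the symmetrised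
  flow arm `imhOpPhi4 J λ q̃ₛ` followed by `φ ↦ −φ` has
  `τ_int(M) = ½ − E_{M̃²}[rₛ/(1 + rₛ)]/Var M` whenever `E_{M̃²}[rₛ/(1 − rₛ)] < ∞`.

Reading for S0-A and the exactness battery (no numerics implied): `τ_int` of an ODD observable is not
a figure of merit of a sampler of an even action — a free random flip drives it to `½`
(`Phi4FlowSymmetrisedSampler` §5) and a free deterministic flip drives it BELOW `½`; a leaderboard row
reporting `τ_int(M) < ½` is the signature of sign alternation, not of decorrelation.  The even
observables of record (`E`, `χ₂`, `G(0,0)`) are untouched by either device.  Antithetic / over-relaxed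
updates NAMED (Adler 1981, Neal 1998, Frigessi–Gåsemyr–Rue 2000); nothing cited as a fact.
NOT CLAIMED: any value of `r` for any network; anything for even observables; HMC / local arms.
-/

namespace Summit.Ventures.LatticeQCDFlow.Exactness

open Real MeasureTheory Filter Finset Set Topology
open Summit.Ventures.LatticeQCDFlow.Scoring

section General

variable {X : Type*} [MeasurableSpace X] {μ : Measure X} [SFinite μ] {w q : X → ℝ} {σ : X → X}

omit [SFinite μ] in
/-- `K` is odd in its argument: `K(−f) = −K f` (pointwise, no hypothesis). -/
theorem imhOp_neg (f : X → ℝ) (x : X) :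
    imhOp μ w q (fun y => -f y) x = -imhOp μ w q f x := by
  unfold imhOp
  rw [← integral_neg]
  refine integral_congr_ae (Eventually.of_forall fun y => ?_)
  show (imhAcceptQ w q x y * -f y + (1 - imhAcceptQ w q x y) * -f x) * q y
    = -((imhAcceptQ w q x y * f y + (1 - imhAcceptQ w q x y) * f x) * q y)
  ring

/-- **`K♭ᵏ g = (−r)ᵏ g` FOR ODD `g`** under a symmetry of `μ`, `w`, `q̃` (`K♭ f = K(f∘σ)`: one exact flow
step, then the deterministic flip). -/
theorem antithetic_iterate_eq_of_odd (hw0 : ∀ t, 0 < w t) (hwm : Measurable w)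
    (hq0 : ∀ t, 0 < q t) (hqm : Measurable q) (hqi : Integrable q μ) (hq1 : ∫ t, q t ∂μ = 1)
    (hσ : ∀ F : X → ℝ, ∫ x, F (σ x) ∂μ = ∫ x, F x ∂μ) (hw : ∀ t, w (σ t) = w t)
    (hq : ∀ t, q (σ t) = q t) :
    ∀ (k : ℕ) {g : X → ℝ}, Measurable g → Integrable (fun t => g t * w t) μ →
      (∀ t, g (σ t) = -g t) → ∀ t,
      ((fun f : X → ℝ => imhOp μ w q (fun y => f (σ y)))^[k] g) t
        = (-(∫ t', (1 - imhAcceptQ w q t t') * q t' ∂μ)) ^ k * g t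
  | 0, _, _, _, _, t => by simp
  | k + 1, g, hgm, hgw, hg, t => by
    obtain ⟨hr0, hr1, hrm⟩ := rejection_bounds (μ := μ) hw0 hwm hq0 hqm hqi hq1
    -- one composite step on the odd `g`: `K(g∘σ) = K(−g) = −K g = −r g`
    have e : (imhOp μ w q (fun y => g (σ y)))
        = fun s => (-(∫ t', (1 - imhAcceptQ w q s t') * q t' ∂μ)) * g s := by
      funext s
      have e1 : (fun y => g (σ y)) = fun y => -g y := funext hg
      rw [e1, imhOp_neg, imhOp_eq_rejection_mul_of_odd hw0 hwm hq0 hqm hqi hq1 hσ hw hq hgm hgw hg s]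
      ring
    -- `(−r)·g` is measurable, in `L¹(w)`, and odd
    have h1 : Measurable fun s => (-(∫ t', (1 - imhAcceptQ w q s t') * q t' ∂μ)) * g s :=
      hrm.neg.mul hgm
    have h2 : Integrable (fun s => (-(∫ t', (1 - imhAcceptQ w q s t') * q t' ∂μ)) * g s * w s) μ := by
      refine Integrable.mono' hgw.abs (h1.mul hwm).aestronglyMeasurable
        (Eventually.of_forall fun s => ?_)
      rw [Real.norm_eq_abs, abs_mul, abs_mul, abs_neg, abs_of_nonneg (hr0 s), abs_mul]
      calc (∫ t', (1 - imhAcceptQ w q s t') * q t' ∂μ) * |g s| * |w s| ≤ 1 * |g s| * |w s| :=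
            mul_le_mul_of_nonneg_right (mul_le_mul_of_nonneg_right (hr1 s) (abs_nonneg _))
              (abs_nonneg _)
        _ = |g s| * |w s| := by ring
    have h3 : ∀ s, (-(∫ t', (1 - imhAcceptQ w q (σ s) t') * q t' ∂μ)) * g (σ s)
        = -((-(∫ t', (1 - imhAcceptQ w q s t') * q t' ∂μ)) * g s) := fun s => by
      rw [rejection_comp_symm hw hq, hg]; ring
    rw [Function.iterate_succ_apply, e,
      antithetic_iterate_eq_of_odd hw0 hwm hq0 hqm hqi hq1 hσ hw hq k h1 h2 h3 t]
    ring

/-- The antithetic autocovariances: `∫ g (K♭ᵏ g) w = ∫ g² w (−r)ᵏ`. -/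
theorem antithetic_autocov_eq_of_odd (hw0 : ∀ t, 0 < w t) (hwm : Measurable w)
    (hq0 : ∀ t, 0 < q t) (hqm : Measurable q) (hqi : Integrable q μ) (hq1 : ∫ t, q t ∂μ = 1)
    (hσ : ∀ F : X → ℝ, ∫ x, F (σ x) ∂μ = ∫ x, F x ∂μ) (hw : ∀ t, w (σ t) = w t)
    (hq : ∀ t, q (σ t) = q t) {g : X → ℝ} (hgm : Measurable g)
    (hgw : Integrable (fun t => g t * w t) μ) (hg : ∀ t, g (σ t) = -g t) (k : ℕ) :
    ∫ t, g t * (((fun f : X → ℝ => imhOp μ w q (fun y => f (σ y)))^[k] g) t) * w t ∂μ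
      = ∫ t, g t ^ 2 * w t * (-(∫ t', (1 - imhAcceptQ w q t t') * q t' ∂μ)) ^ k ∂μ := by
  refine integral_congr_ae (Eventually.of_forall fun t => ?_)
  show g t * (((fun f : X → ℝ => imhOp μ w q (fun y => f (σ y)))^[k] g) t) * w t
    = g t ^ 2 * w t * (-(∫ t', (1 - imhAcceptQ w q t t') * q t' ∂μ)) ^ k
  rw [antithetic_iterate_eq_of_odd hw0 hwm hq0 hqm hqi hq1 hσ hw hq k hgm hgw hg t]
  ring

/-- **THE ALTERNATING GREEN–KUBO SERIES**: `∫ g² w r/(1 − r) < ∞` ⇒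
`Σ_{k≥0} C♭_g(k+1) = −∫ g² w r/(1 + r)` (absolutely convergent; dominated convergence). -/
theorem antithetic_hasSum_autocov_of_odd (hw0 : ∀ t, 0 < w t) (hwm : Measurable w)
    (hwi : Integrable w μ) (hq0 : ∀ t, 0 < q t) (hqm : Measurable q) (hqi : Integrable q μ)
    (hq1 : ∫ t, q t ∂μ = 1) (hσ : ∀ F : X → ℝ, ∫ x, F (σ x) ∂μ = ∫ x, F x ∂μ)
    (hw : ∀ t, w (σ t) = w t) (hq : ∀ t, q (σ t) = q t) {g : X → ℝ} (hgm : Measurable g)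
    (hg2 : Integrable (fun t => g t ^ 2 * w t) μ) (hg : ∀ t, g (σ t) = -g t)
    (hS : Integrable (fun t => g t ^ 2 * w t * ((∫ t', (1 - imhAcceptQ w q t t') * q t' ∂μ)
      / (1 - ∫ t', (1 - imhAcceptQ w q t t') * q t' ∂μ))) μ) :
    HasSum (fun k => ∫ t, g t * (((fun f : X → ℝ => imhOp μ w q (fun y => f (σ y)))^[k + 1] g) t)
        * w t ∂μ)
      (-∫ t, g t ^ 2 * w t * ((∫ t', (1 - imhAcceptQ w q t t') * q t' ∂μ)
        / (1 + ∫ t', (1 - imhAcceptQ w q t t') * q t' ∂μ)) ∂μ) := by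
  obtain ⟨hr0, hr1, hrm⟩ := rejection_bounds (μ := μ) hw0 hwm hq0 hqm hqi hq1
  set r : X → ℝ := fun t => ∫ t', (1 - imhAcceptQ w q t t') * q t' ∂μ with hr
  have hgw := integrable_mul_weight_of_sq (fun t => (hw0 t).le) hwm hwi hgm hg2
  have hrlt : ∀ t, r t < 1 := fun t => by
    show (∫ t', (1 - imhAcceptQ w q t t') * q t' ∂μ) < 1
    rw [rejection_eq_rejCurve hw0 hq0 t]
    exact rejCurve_lt_one hw0 hwm hq0 hqm hqi hq1 (div_pos (hw0 t) (hq0 t))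
  -- termwise: `C♭(k+1) = ∫ g² w (−r)^{k+1}`, `|C♭(k+1)| ≤ m_{k+1} = ∫ g² w r^{k+1}`
  have hterm : ∀ k, ∫ t, g t * (((fun f : X → ℝ => imhOp μ w q (fun y => f (σ y)))^[k + 1] g) t)
      * w t ∂μ = ∫ t, g t ^ 2 * w t * (-r t) ^ (k + 1) ∂μ :=
    fun k => antithetic_autocov_eq_of_odd hw0 hwm hq0 hqm hqi hq1 hσ hw hq hgm hgw hg (k + 1)
  have habs_int : ∀ k, Integrable (fun t => g t ^ 2 * w t * r t ^ (k + 1)) μ := by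
    intro k
    refine Integrable.mono' hg2 (((hgm.pow_const 2).mul hwm).mul (hrm.pow_const _)).aestronglyMeasurable
      (Eventually.of_forall fun t => ?_)
    rw [Real.norm_eq_abs, abs_of_nonneg (mul_nonneg (mul_nonneg (sq_nonneg _) (hw0 t).le)
      (pow_nonneg (hr0 t) _))]
    exact mul_le_of_le_one_right (mul_nonneg (sq_nonneg _) (hw0 t).le) (pow_le_one₀ (hr0 t) (hr1 t))
  have halt_int : ∀ k, Integrable (fun t => g t ^ 2 * w t * (-r t) ^ (k + 1)) μ := by
    intro k
    refine Integrable.mono' (habs_int k) (((hgm.pow_const 2).mul hwm).mul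
      (hrm.neg.pow_const _)).aestronglyMeasurable (Eventually.of_forall fun t => ?_)
    rw [Real.norm_eq_abs, abs_mul, abs_of_nonneg (mul_nonneg (sq_nonneg _) (hw0 t).le), abs_pow,
      abs_neg, abs_of_nonneg (hr0 t)]
  -- absolute summability from the sticking column: `Σ m_{k+1} = ∫ g² w r/(1 − r)`
  have hM := imhOp_hasSum_autocov_of_odd hw0 hwm hwi hq0 hqm hqi hq1 hσ hw hq hgm hg2 hg hS
  have hMterm : ∀ k, ∫ t, g t * ((imhOp μ w q)^[k + 1] g) t * w t ∂μ
      = ∫ t, g t ^ 2 * w t * r t ^ (k + 1) ∂μ :=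
    fun k => imhOp_autocov_eq_sticking_of_odd hw0 hwm hq0 hqm hqi hq1 hσ hw hq hgm hgw hg (k + 1)
  have hsumM : Summable fun k => ∫ t, g t ^ 2 * w t * r t ^ (k + 1) ∂μ := by
    have h := hM.summable
    simp_rw [hMterm] at h
    exact h
  have hsum : Summable fun k => ∫ t, g t ^ 2 * w t * (-r t) ^ (k + 1) ∂μ := by
    refine Summable.of_norm_bounded hsumM fun k => ?_
    rw [Real.norm_eq_abs]
    calc |∫ t, g t ^ 2 * w t * (-r t) ^ (k + 1) ∂μ| ≤ ∫ t, |g t ^ 2 * w t * (-r t) ^ (k + 1)| ∂μ :=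
          abs_integral_le_integral_abs
      _ = ∫ t, g t ^ 2 * w t * r t ^ (k + 1) ∂μ := by
          refine integral_congr_ae (Eventually.of_forall fun t => ?_)
          show |g t ^ 2 * w t * (-r t) ^ (k + 1)| = g t ^ 2 * w t * r t ^ (k + 1)
          rw [abs_mul, abs_of_nonneg (mul_nonneg (sq_nonneg _) (hw0 t).le), abs_pow, abs_neg,
            abs_of_nonneg (hr0 t)]
  -- identify the sum by dominated convergence of the alternating geometric partial sums
  simp_rw [hterm]
  have hgeo : ∀ t, HasSum (fun k => (-r t) ^ (k + 1)) (-(r t / (1 + r t))) := by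
    intro t
    have habs : |(-r t)| < 1 := by rw [abs_neg, abs_of_nonneg (hr0 t)]; exact hrlt t
    have h := (hasSum_geometric_of_abs_lt_one habs).mul_left (-r t)
    have hden : (1 + r t) ≠ 0 := by linarith [hr0 t]
    have e : -r t * (1 - -r t)⁻¹ = -(r t / (1 + r t)) := by
      rw [sub_neg_eq_add]
      field_simp
    rw [e] at h
    exact h.congr_fun fun k => by ring
  have hlim : Tendsto (fun N => ∑ k ∈ Finset.range N, ∫ t, g t ^ 2 * w t * (-r t) ^ (k + 1) ∂μ) atTop
      (𝓝 (-∫ t, g t ^ 2 * w t * (r t / (1 + r t)) ∂μ)) := by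
    have hpart : ∀ N, ∑ k ∈ Finset.range N, ∫ t, g t ^ 2 * w t * (-r t) ^ (k + 1) ∂μ
        = ∫ t, g t ^ 2 * w t * ∑ k ∈ Finset.range N, (-r t) ^ (k + 1) ∂μ := by
      intro N
      rw [← integral_finsetSum _ fun k _ => halt_int k]
      refine integral_congr_ae (Eventually.of_forall fun t => ?_)
      simp only [Finset.mul_sum]
    simp_rw [hpart]
    rw [← integral_neg]
    refine tendsto_integral_of_dominated_convergence
      (fun t => g t ^ 2 * w t * (r t / (1 - r t)))
      (fun N => (((hgm.pow_const 2).mul hwm).mul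
        (Finset.measurable_sum _ fun k _ => hrm.neg.pow_const _)).aestronglyMeasurable) hS
      (fun N => Eventually.of_forall fun t => ?_) (Eventually.of_forall fun t => ?_)
    · -- `|Σ_{k<N} (−r)^{k+1}| ≤ Σ_{k<N} r^{k+1} ≤ r/(1 − r)`
      rw [Real.norm_eq_abs, abs_mul, abs_of_nonneg (mul_nonneg (sq_nonneg _) (hw0 t).le)]
      refine mul_le_mul_of_nonneg_left ?_ (mul_nonneg (sq_nonneg _) (hw0 t).le)
      have hgeo' : HasSum (fun k => r t ^ (k + 1)) (r t / (1 - r t)) := by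
        have h := (hasSum_geometric_of_lt_one (hr0 t) (hrlt t)).mul_left (r t)
        have e : r t * (1 - r t)⁻¹ = r t / (1 - r t) := by rw [div_eq_mul_inv]
        rw [e] at h
        exact h.congr_fun fun k => by ring
      calc |∑ k ∈ Finset.range N, (-r t) ^ (k + 1)| ≤ ∑ k ∈ Finset.range N, |(-r t) ^ (k + 1)| :=
            Finset.abs_sum_le_sum_abs _ _
        _ = ∑ k ∈ Finset.range N, r t ^ (k + 1) :=
            Finset.sum_congr rfl fun k _ => by rw [abs_pow, abs_neg, abs_of_nonneg (hr0 t)]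
        _ ≤ r t / (1 - r t) := sum_le_hasSum (Finset.range N) (fun k _ => pow_nonneg (hr0 t) _) hgeo'
    · have h := ((hgeo t).tendsto_sum_nat).const_mul (g t ^ 2 * w t)
      have e : g t ^ 2 * w t * -(r t / (1 + r t)) = -(g t ^ 2 * w t * (r t / (1 + r t))) := by ring
      rw [e] at h
      exact h
  exact (hsum.hasSum_iff_tendsto_nat.2 hlim)

/-- **`τ_int♭(g) = ½ − E_{g²w}[r/(1 + r)]` — BELOW ONE HALF.**  `w, q̃ > 0` measurable integrable,
`∫ q̃ = 1`; `σ` a symmetry of `μ`, `w`, `q̃`; `g` odd, measurable, square-integrable,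
`∫ g² w r/(1 − r) < ∞`.  Then the normalised series of `g` under the composite 'exact flow step, then
flip' is summable and `τ_int♭(g) = ½ − (∫ g² w r/(1 + r))/∫ g² w`. -/
theorem antithetic_tauInt_eq_of_odd (hw0 : ∀ t, 0 < w t) (hwm : Measurable w)
    (hwi : Integrable w μ) (hq0 : ∀ t, 0 < q t) (hqm : Measurable q) (hqi : Integrable q μ)
    (hq1 : ∫ t, q t ∂μ = 1) (hσ : ∀ F : X → ℝ, ∫ x, F (σ x) ∂μ = ∫ x, F x ∂μ)
    (hw : ∀ t, w (σ t) = w t) (hq : ∀ t, q (σ t) = q t) {g : X → ℝ} (hgm : Measurable g)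
    (hg2 : Integrable (fun t => g t ^ 2 * w t) μ) (hg : ∀ t, g (σ t) = -g t)
    (hS : Integrable (fun t => g t ^ 2 * w t * ((∫ t', (1 - imhAcceptQ w q t t') * q t' ∂μ)
      / (1 - ∫ t', (1 - imhAcceptQ w q t t') * q t' ∂μ))) μ) :
    (Summable fun k => (∫ t, g t * (((fun f : X → ℝ => imhOp μ w q (fun y => f (σ y)))^[k + 1] g) t)
        * w t ∂μ) / ∫ t, g t ^ 2 * w t ∂μ) ∧
    tauInt (fun k => (∫ t, g t * (((fun f : X → ℝ => imhOp μ w q (fun y => f (σ y)))^[k] g) t)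
        * w t ∂μ) / ∫ t, g t ^ 2 * w t ∂μ)
      = 1 / 2 - (∫ t, g t ^ 2 * w t * ((∫ t', (1 - imhAcceptQ w q t t') * q t' ∂μ)
          / (1 + ∫ t', (1 - imhAcceptQ w q t t') * q t' ∂μ)) ∂μ) / ∫ t, g t ^ 2 * w t ∂μ := by
  have h := (antithetic_hasSum_autocov_of_odd hw0 hwm hwi hq0 hqm hqi hq1 hσ hw hq hgm hg2 hg
    hS).div_const (∫ t, g t ^ 2 * w t ∂μ)
  refine ⟨h.summable, ?_⟩
  unfold tauInt
  rw [h.tsum_eq]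
  ring

end General

/-! ## The lattice: the symmetrised flow arm of every network, followed by `φ ↦ −φ` -/

section Lattice

variable {n : ℕ}

/-- **FOR EVERY NETWORK, THE SYMMETRISED φ⁴ FLOW ARM FOLLOWED BY THE SIGN FLIP HAS
`τ_int(M) = ½ − E_{M̃²}[rₛ/(1 + rₛ)]/Var M < ½`** whenever `E_{M̃²}[rₛ/(1 − rₛ)] < ∞` (every `λ > 0`, real
`J`, positive measurable model density with `∫ q̃ = 1`; `q̃ₛ = ½(q̃ + q̃∘(−))`, `rₛ` its rejection
probability): the magnetisation's `τ_int` is pushed below the independent-sampling value for free —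
which is why it is not a figure of merit. -/
theorem phi4FlowAntithetic_tauInt_magnetisation_eq {lam : ℝ} (hlam : 0 < lam)
    (J : Fin (n + 1) → Fin (n + 1) → ℝ) {q : (Fin (n + 1) → ℝ) → ℝ} (hq0 : ∀ φ, 0 < q φ)
    (hqm : Measurable q) (hqi : Integrable q) (hq1 : ∫ φ, q φ = 1)
    (hS : Integrable (fun φ : Fin (n + 1) → ℝ =>
      ((∑ x, φ x) - gibbsExpect J lam (fun ψ => ∑ x, ψ x)) ^ 2 * gibbsWeight J lam φ
        * ((∫ φ', (1 - imhAcceptQ (gibbsWeight J lam) (fun ψ => (q ψ + q (-ψ)) / 2) φ φ')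
              * ((q φ' + q (-φ')) / 2))
          / (1 - ∫ φ', (1 - imhAcceptQ (gibbsWeight J lam) (fun ψ => (q ψ + q (-ψ)) / 2) φ φ')
              * ((q φ' + q (-φ')) / 2))))) :
    (Summable fun k => (∫ φ, ((∑ x, φ x) - gibbsExpect J lam (fun ψ => ∑ x, ψ x))
        * (((fun f : (Fin (n + 1) → ℝ) → ℝ =>
              imhOpPhi4 J lam (fun ψ => (q ψ + q (-ψ)) / 2) (fun ψ => f (-ψ)))^[k + 1]
            (fun ψ => (∑ x, ψ x) - gibbsExpect J lam (fun ψ => ∑ x, ψ x))) φ) * gibbsWeight J lam φ)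
        / ∫ φ, ((∑ x, φ x) - gibbsExpect J lam (fun ψ => ∑ x, ψ x)) ^ 2 * gibbsWeight J lam φ) ∧
    tauInt (fun k => (∫ φ, ((∑ x, φ x) - gibbsExpect J lam (fun ψ => ∑ x, ψ x))
        * (((fun f : (Fin (n + 1) → ℝ) → ℝ =>
              imhOpPhi4 J lam (fun ψ => (q ψ + q (-ψ)) / 2) (fun ψ => f (-ψ)))^[k]
            (fun ψ => (∑ x, ψ x) - gibbsExpect J lam (fun ψ => ∑ x, ψ x))) φ) * gibbsWeight J lam φ)
        / ∫ φ, ((∑ x, φ x) - gibbsExpect J lam (fun ψ => ∑ x, ψ x)) ^ 2 * gibbsWeight J lam φ)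
      = 1 / 2 - (∫ φ, ((∑ x, φ x) - gibbsExpect J lam (fun ψ => ∑ x, ψ x)) ^ 2 * gibbsWeight J lam φ
          * ((∫ φ', (1 - imhAcceptQ (gibbsWeight J lam) (fun ψ => (q ψ + q (-ψ)) / 2) φ φ')
                * ((q φ' + q (-φ')) / 2))
            / (1 + ∫ φ', (1 - imhAcceptQ (gibbsWeight J lam) (fun ψ => (q ψ + q (-ψ)) / 2) φ φ')
                * ((q φ' + q (-φ')) / 2))))
        / ∫ φ, ((∑ x, φ x) - gibbsExpect J lam (fun ψ => ∑ x, ψ x)) ^ 2 * gibbsWeight J lam φ := by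
  haveI := isNegInvariant_volume_pi (Λ := Fin (n + 1))
  obtain ⟨hs0, hsm, hsi, hs1, hsym⟩ := symmetrisedDensity_facts hq0 hqm hqi hq1
  obtain ⟨hgm, hg2⟩ := polyObs_sq_integrable hlam J
    (polyObs_sub_const polyObs_magnetisation (gibbsExpect J lam (fun ψ => ∑ x, ψ x)))
  have hodd : ∀ φ : Fin (n + 1) → ℝ, ((∑ x, (-φ) x) - gibbsExpect J lam (fun ψ => ∑ x, ψ x))
      = -((∑ x, φ x) - gibbsExpect J lam (fun ψ => ∑ x, ψ x)) := fun φ => by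
    simp only [Pi.neg_apply, Finset.sum_neg_distrib, gibbsExpect_magnetisation]
    ring
  rw [imhOpPhi4_eq_imhOp]
  exact antithetic_tauInt_eq_of_odd (μ := volume) (σ := fun ψ : Fin (n + 1) → ℝ => -ψ)
    (fun ψ => gibbsWeight_pos J lam ψ) (continuous_gibbsWeight J lam).measurable
    (integrable_gibbsWeight hlam J) hs0 hsm hsi hs1 (fun F => integral_neg_eq_self F volume)
    (fun ψ => gibbsWeight_neg J lam ψ) hsym hgm hg2 hodd hS

end Lattice

end Summit.Ventures.LatticeQCDFlow.Exactness
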